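import Summits.CriticalPhenomena.PercolationContinuityZ3.Theorems.Transplant.SkelSign2ParamsRoot
import Summits.CriticalPhenomena.PercolationContinuityZ3.Theorems.Transplant.SkelPhiRootSchedAssembly
import Summits.CriticalPhenomena.PercolationContinuityZ3.Theorems.Transplant.KNCells2RootRunStd
import Summits.CriticalPhenomena.PercolationContinuityZ3.Theorems.Transplant.SkelPhiRootRadii
import Summits.CriticalPhenomena.PercolationContinuityZ3.Theorems.Transplant.SkelSignChoiceAll
import HarnessLib

/-!
# D″ node, OPTION C (multi-type), (R) wrapper: **`PlanarSkeletonSign.rootHoldsFnAll_signChoiceAll : RootHoldsFnAll signChoiceAll`** — the ROOT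
# RESIDUE of the multi-type closure `samePDropOfSkeletonSign_of_choiceFnAll signChoiceAll wfHoldsFnAll_signChoiceAll rootHoldsFnAll_signChoiceAll
# faceHoldsRFnAll_… reachHoldsRHFnAll_…` (p3-g7 `SkelSignChoiceRef` p254929 / `SkelSignChoiceAll`), i.e. the single-type (R) wrapper
# `rootHoldsFn_signChoice₂` (`SkelPhiRootHolds`, p2-g8 text) with the binder `Φ.types = {t}` DROPPED: the only place that binder was used is the
# Step-I′ certificate at `q`, which the residue `Skelφ.rootOblT_concSG_sched` (p2-g8 `SkelPhiRootSchedAssembly`) wants over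
# `StepI.index Φ.types (Sz O) (Sx O) (Sy O)` — exactly the family the all-types premise `AtQAll O q` carries; every other number / radius /
# count / kit / first-hop fact is stmt-g9's `Sgn₂.*` dictionary (`SkelSign2ParamsAtQ/AtQ2/Depth/Counts/Widths/Root`) read through
# `AtQAll.atQ ht : AtQ O q`.  Same instantiation as `SkelPhiRootHolds` (standard root band run `rootSchedRO … (rootBandOKR_std …)`, short stride
# `e∥`, `nStd ≤ 12A` steps, F-DP4-2 rooted admissibility `BandOKR`)

builds on p205010 (kernel theorem, internal audit signed; external expert review pending) — nothing in this file uses p205010.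
Status sentence (coordinator 2026-08-20T04:30Z): "θ(p_c) = 0 on ℤ^d, all d ≥ 2 — kernel-verified (Lean 4/Mathlib, standard axioms); internal
adversarial audit SIGNED 2026-08-20 04:29Z; external expert review pending."
Lane `prim-bschramm-*`, seat `prim-bschramm-p2` (gen 9; (R) = p2 lineage under D″; option C second closing per the lead's node-level ruling
2026-08-21T07:20:22Z — this file closes nothing by itself); helper file (`--supports stmt-CriticalPhenomena-4575`).
* **`PlanarSkeletonSign.rootHoldsFnAll_signChoiceAll`**.
[cite: KozmaNitzan2024, §4 Theorem 6 (pp. 27–28: (32) at the root), Lemma 9 (p. 16), Lemma 10 (pp. 17–22), Lemma 11 (pp. 22–23), Lemma 12 (p. 24)]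
-/

noncomputable section

open MeasureTheory ProbabilityTheory
open scoped ENNReal Classical

namespace Summit.CriticalPhenomena.PercolationContinuityZ3.Theorems.Transplant

namespace PlanarSkeletonSign

open Literature.Probability.Percolation Literature.Probability.LatticeModels SimpleGraph KNCells KNLevels
open Literature.Probability.Percolation.KozmaNitzan
open Literature.Probability.Percolation.KozmaNitzan.Cells (oth sgOf sgOf_sign)
open Literature.Barriers.CriticalPhenomena (graphBall)
open SkelConc (Consts)
open BoxProdZ2 (ConcRadiiG Erad Frad rootCtr)
open SkelI (tanOff)

/-- **THE ROOT RESIDUE OF THE MULTI-TYPE D″ NODE** ((R), KN §4 (32) at the root, ALL TYPES): `RootHoldsFnAll signChoiceAll` — the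
premise `AtQAll O q` carries the Step-I′ family over `StepI.index Φ.types …`, which is exactly what the schedule-generic residue
`Skelφ.rootOblT_concSG_sched` consumes; every other fact is read from stmt-g9's `Sgn₂.*` dictionary through `AtQAll.atQ`.
[cite: KozmaNitzan2024, §4 Theorem 6 (pp. 27–28: (32) at the root), Lemma 11 (pp. 22–23), Lemma 12 (p. 24)] -/
theorem rootHoldsFnAll_signChoiceAll : RootHoldsFnAll signChoiceAll := by
  intro κ V _ _ G _ Φ hg t ht h0 p hp0 hp1 hC
  rw [signChoiceAll_eq]
  intro O q hatA
  have hat : (Sgn₂.choiceAt κ Φ t p hC).AtQ O q := hatA.atQ ht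
  -- ### the standard root band run, per direction (`N du + 1 = nStd ≤ 12 A`, inside the accuracy table)
  have hstd := fun (du : MDir) => Sgn₂.root_std_at hat du.1
  have hOKR : ∀ du : MDir, RootRun2.RootBandOKR (Sgn₂.cells κ Φ p O) du (Sgn₂.e κ Φ p O du.1) (Sgn.R' κ Φ p O)
      (Sgn₂.e κ Φ p O du.1 - Sgn.R' κ Φ p O) (RootRun2.nStd ((Sgn₂.cells κ Φ p O).r du.1) (Sgn₂.e κ Φ p O du.1) (Sgn.R' κ Φ p O) - 1)
      (Sgn₂.WMR κ Φ p O du.1) (Sgn₂.WbR κ Φ p O du.1) (RootRun2.caStd ((Sgn₂.cells κ Φ p O).r du.1) (Sgn₂.e κ Φ p O du.1) (Sgn.R' κ Φ p O)) 0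
      (Sgn₂.qR' κ Φ p O du.1 : ℤ)
      ((Sgn₂.qR' κ Φ p O du.1 : ℤ) + (RootRun2.nStd ((Sgn₂.cells κ Φ p O).r du.1) (Sgn₂.e κ Φ p O du.1) (Sgn.R' κ Φ p O) : ℤ) * (Sgn.R' κ Φ p O) +
        2 * (Sgn₂.WMR κ Φ p O du.1 : ℤ)) := by
    intro du
    obtain ⟨h1e, h2R, hbig, he6, hNR, hq8, hW8, hWb⟩ := hstd du
    exact RootRun2.rootBandOKR_std (Sgn₂.cells κ Φ p O) du h1e h2R hbig he6 (by positivity) (by exact_mod_cast hq8) hW8 hNR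
      (fun ℓ hℓ => hWb ℓ (by push_cast at hℓ; omega))
  have hNle : ∀ du : MDir, (RootRun2.rootSchedRO (Sgn₂.cells κ Φ p O) du (hOKR du)).N ≤ Skelφ.Prm.nmax (Sgn.A κ) := by
    intro du
    obtain ⟨h1e, -, hbig, -⟩ := hstd du
    have h12 := RootRun2.nStd_mul_le_twelve (r := (Sgn₂.cells κ Φ p O).r du.1) (R' := Sgn.R' κ Φ p O) h1e hbig
    have hr : (((Sgn₂.cells κ Φ p O).r du.1 : ℕ) : ℤ) = (Sgn.A κ : ℤ) * (Sgn₂.e κ Φ p O du.1 : ℤ) := by exact_mod_cast Sgn₂.cells_r_at hat du.1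
    have he0 : (0 : ℤ) < Sgn₂.e κ Φ p O du.1 := by exact_mod_cast h1e
    have hn : (RootRun2.nStd ((Sgn₂.cells κ Φ p O).r du.1) (Sgn₂.e κ Φ p O du.1) (Sgn.R' κ Φ p O) : ℤ) ≤ 12 * (Sgn.A κ : ℤ) := by
      rw [hr] at h12
      nlinarith
    have hn' : RootRun2.nStd ((Sgn₂.cells κ Φ p O).r du.1) (Sgn₂.e κ Φ p O du.1) (Sgn.R' κ Φ p O) ≤ 12 * Sgn.A κ := by exact_mod_cast hn
    have := Sgn₂.twelve_A_le_nmax κ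
    rw [RootRun2.rootSchedRO_N]; omega
  have hacc := fun (du : MDir) => Sgn₂.acc_at_length hat _ (hNle du) hp0 hp1
  -- ### the planar facts of the root schedules
  have hca25 : ∀ du : MDir, RootRun2.caStd ((Sgn₂.cells κ Φ p O).r du.1) (Sgn₂.e κ Φ p O du.1) (Sgn.R' κ Φ p O) ≤ 25 * ((Sgn₂.cells κ Φ p O).r du.1 : ℤ) := by
    intro du
    obtain ⟨-, -, hbig, -⟩ := hstd du
    have : ((Sgn₂.e κ Φ p O du.1 : ℕ) : ℤ) + 2 * (Sgn.R' κ Φ p O) + 2 ≤ 12 * ((Sgn₂.cells κ Φ p O).r du.1 : ℤ) := by exact_mod_cast hbig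
    unfold RootRun2.caStd; linarith
  have hq'5 : ∀ du : MDir, (Sgn₂.qR' κ Φ p O du.1 : ℤ) ≤ 5 * ((Sgn₂.cells κ Φ p O).r (oth du.1) : ℤ) - 1 := by
    intro du
    obtain ⟨-, -, -, -, -, hq8, -⟩ := hstd du
    have : 8 * (Sgn₂.qR' κ Φ p O du.1 : ℤ) ≤ ((Sgn₂.cells κ Φ p O).r (oth du.1) : ℤ) := by exact_mod_cast hq8
    have h1 : (1 : ℤ) ≤ (Sgn₂.cells κ Φ p O).r (oth du.1) := by exact_mod_cast (Sgn₂.cells κ Φ p O).one_le_r (oth du.1)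
    linarith
  -- ### the level window and the counts
  have hlev := Sgn₂.levels_at (κ := κ) (Φ := Φ) (p := p) (O := O)
  have hcount : ∀ du : MDir, 1 / (1 - (q : ℝ)) ^ (Φ.Δ * Sgn.NP κ Φ p O) ≤
      κ.δr (RootRun2.rootSchedRO (Sgn₂.cells κ Φ p O) du (hOKR du)).N * ((Finset.Icc (Sgn.T₀ O) (Sgn.Rlev κ Φ p O)).card : ℝ) := by
    intro du
    rw [hlev.2.1]
    exact (hacc du).2.2.2.2.2.2 _ (Nat.le_succ _)
  -- ### the schedule's radii at the root (`Rt + 1 = F 1 − L′`, `rQ 0 0 = E₀`)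
  have hΛ : Sgn₂.Λ κ Φ p O q = Skelφ.concRadii2S (Sgn₂.cells κ Φ p O) (Skelφ.Prm.gap (Sgn₂.schedIn κ Φ p O q)) (fun _ => 0)
      (Skelφ.Prm.E₀ (Sgn₂.schedIn κ Φ p O q)) (Skelφ.Prm.Lp (Sgn₂.schedIn κ Φ p O q)) := Sgn₂.Λ_eq
  have hRtF := Sgn₂.Rt_facts (κ := κ) (Φ := Φ) (p := p) (O := O) (q := q)
  have hE := Sgn₂.E₀_at hat
  have hE1 : 1 ≤ Skelφ.Prm.E₀ (Sgn₂.schedIn κ Φ p O q) := by have := hE.1; omega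
  have hLF : Skelφ.Prm.Lp (Sgn₂.schedIn κ Φ p O q) + 1 ≤
      Frad (Skelφ.Prm.gap (Sgn₂.schedIn κ Φ p O q)) (fun _ => 0) (Skelφ.Prm.E₀ (Sgn₂.schedIn κ Φ p O q)) 1 := by have := hRtF.1; omega
  have hRtdef : Sgn₂.Rt κ Φ p O q = Frad (Skelφ.Prm.gap (Sgn₂.schedIn κ Φ p O q)) (fun _ => 0) (Skelφ.Prm.E₀ (Sgn₂.schedIn κ Φ p O q)) 1 -
      Skelφ.Prm.Lp (Sgn₂.schedIn κ Φ p O q) - 1 := rfl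
  have hrad := fun (du : MDir) => Skelφ.root_radii_concRadii2S' (Sgn₂.cells κ Φ p O) (Skelφ.Prm.gap (Sgn₂.schedIn κ Φ p O q)) (fun _ => 0)
    (Skelφ.Prm.E₀ (Sgn₂.schedIn κ Φ p O q)) (Skelφ.Prm.Lp (Sgn₂.schedIn κ Φ p O q)) hE1 hLF du
  have hRB : ∀ du, Sgn₂.Rt κ Φ p O q + 1 ≤ (Sgn₂.Λ κ Φ p O q).rB 0 0 du := fun du => by rw [hΛ, hRtdef]; exact (hrad du).1
  have hRQ : ∀ du, Sgn₂.Rt κ Φ p O q + 1 ≤ (Sgn₂.Λ κ Φ p O q).rQ 0 ((0 : Site 2) + stepVec du) := fun du => by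
    rw [hΛ, hRtdef]; exact (hrad du).2.1
  have hRM : ∀ du, Sgn₂.Rt κ Φ p O q + 1 ≤ (Sgn₂.Λ κ Φ p O q).rM 0 ((0 : Site 2) + stepVec du) := fun du => by
    rw [hΛ, hRtdef]; exact (hrad du).2.2
  have hQE : (Sgn₂.Λ κ Φ p O q).rQ 0 0 ≤ Skelφ.Prm.E₀ (Sgn₂.schedIn κ Φ p O q) := by
    rw [hΛ]
    exact (Skelφ.root_radii_concRadii2S (Sgn₂.cells κ Φ p O) (Skelφ.Prm.gap (Sgn₂.schedIn κ Φ p O q)) (fun _ => 0)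
      (Skelφ.Prm.E₀ (Sgn₂.schedIn κ Φ p O q)) (Skelφ.Prm.Lp (Sgn₂.schedIn κ Φ p O q)) hE1 (0, true)).2.2.2
  have hEQ : Skelφ.Prm.E₀ (Sgn₂.schedIn κ Φ p O q) ≤ (Sgn₂.Λ κ Φ p O q).rQ 0 0 := by
    rw [hΛ, Skelφ.concRadii2S_rQ, Skel.nQ_zero_zero, BoxProdZ2.Erad_zero]; exact le_max_left _ _
  -- ### the kit at the zone scale, the first hop
  have hRΛ := Sgn₂.R_Λ_eq hat
  have hρz : Skelφ.fatRadius Φ.frame hC (Sgn.Mu O) + O.off = Sgn.ρz O := by rw [← hRΛ.1]; rfl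
  have hrs : Sgn.rs Φ O ≤ Sgn₂.r₀ κ Φ p O := by unfold Sgn₂.r₀; omega
  have hhop := fun (du : MDir) => Sgn₂.first_hop_at hat du.1
  have hdep := fun (du : MDir) => Sgn₂.first_hop_depths_at hat du.1
  have hcaR : ∀ du : MDir, RootRun2.caStd ((Sgn₂.cells κ Φ p O).r du.1) (Sgn₂.e κ Φ p O du.1) (Sgn.R' κ Φ p O) = (Sgn₂.caR κ Φ p O du.1 : ℤ) :=
    fun du => by unfold RootRun2.caStd Sgn₂.caR; push_cast; ring
  -- ### assemble: one call of the schedule-generic (R) residue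
  show Skel.RootOblT G (⟨Skelφ.cellGeomSG G Φ.φ (Sgn₂.cells κ Φ p O) t (Sgn₂.Λ κ Φ p O q), q, κ.δ⟩ : KSchA V ℕ) Φ.Δ κ.δr
  exact Skelφ.rootOblT_concSG_sched Φ.lip Φ.step Φ.frame Φ.cyl_connected Φ.degree_le hC (Sgn₂.cells κ Φ p O) t Sgn₂.WFS2_at h0 q κ.δ
    (Δ' := Φ.Δ) (δr := κ.δr) (Rt := Sgn₂.Rt κ Φ p O q) (L' := Skelφ.Prm.Lp (Sgn₂.schedIn κ Φ p O q)) (E₀ := Skelφ.Prm.E₀ (Sgn₂.schedIn κ Φ p O q))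
    (fun du => RootRun2.rootSchedRO (Sgn₂.cells κ Φ p O) du (hOKR du))
    (Rlev := fun _ => Sgn.Rlev κ Φ p O) (Nc := fun _ => Sgn.NP κ Φ p O) (j₀ := fun _ => Sgn.T₀ O) (j₁ := fun _ => Sgn.Rlev κ Φ p O)
    (ca := fun du => RootRun2.caStd ((Sgn₂.cells κ Φ p O).r du.1) (Sgn₂.e κ Φ p O du.1) (Sgn.R' κ Φ p O)) (q' := fun du => (Sgn₂.qR' κ Φ p O du.1 : ℤ))
    (fun du k hk => RootRun2.rootSchedRO_region_subset (hOKR du) hk) (fun du k hk => RootRun2.rootSchedRO_region_disjoint_Q (hOKR du) hk)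
    (fun du => RootRun2.rootSchedRO_core_last_subset_M (hOKR du)) (fun du => by rw [RootRun2.rootSchedRO_core_zero])
    hca25 hq'5 (fun _ => hlev.2.2.2.le) (fun _ => le_rfl) hRB hRQ hRM hRtF.2.2.1 hQE
    (fun du => (hacc du).2.2.2.1) (fun du => (hacc du).2.2.2.2.1) hcount
    (D := O.D) (off := O.off) hRΛ.2 (Sz := Sgn.Sz O) (Sx := Sgn₂.Sx κ Φ p O) (Sy := Sgn₂.Sy κ Φ p O) (δI := Sgn.δI κ Φ)
    (fun i hi => hatA.2.2.2.2.2.1 i hi) (fun du => (hacc du).2.1)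
    (Mz := Sgn.Mu O) (Sgn₂.mem_lists_at (κ := κ) (Φ := Φ) (p := p) (O := O)).1 (Sgn₂.Mu_facts hat).2.2.2
    (ℓK := Skelφ.Prm.ℓK (Sgn.Mu O))
    (fun I _ => by rw [Skelφ.Prm.ℓK_eq]; exact (Sgn₂.mem_lists_at (κ := κ) (Φ := Φ) (p := p) (O := O)).2.1)
    (fun I _ => by rw [Skelφ.Prm.ℓK_eq]; exact (Sgn₂.mem_lists_at (κ := κ) (Φ := Φ) (p := p) (O := O)).2.2.1)
    (A := Skelφ.Prm.A O.D (Sgn.Mu O)) (Rk := Skelφ.Prm.Rk O.D (Sgn.Mu O)) (Skelφ.Prm.hAw O.D (Sgn.Mu O)) (Skelφ.Prm.hRk O.D (Sgn.Mu O))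
    (ℓs := Sgn.M O) (M := Sgn.M O) (K := Sgn.Kd O) (Rsd := Sgn.Rseed Φ O) (r₀ := Sgn₂.r₀ κ Φ p O) (rs := Sgn.rs Φ O) (cU := Sgn.cU Φ O)
    (Skelφ.Prm.one_le_M O.D (Sgn.Mu O)) (fun _ => hlev.1.le) (Skelφ.Prm.hA O.D (Sgn.Mu O)) (Skelφ.Prm.hAℓ O.D (Sgn.Mu O))
    (Skelφ.Prm.hK O.D (Sgn.Mu O) (Sgn.ρz O)) (Skelφ.Prm.hnA O.D (Sgn.Mu O)) (Skelφ.Prm.hnM O.D (Sgn.Mu O))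
    (fun i => by rw [hρz]; exact Skelφ.Prm.hρK O.D (Sgn.Mu O) (Sgn.ρz O) i)
    (Skelφ.Prm.hR'₁ O.D (Sgn.Mu O) G Φ.φ Φ.types) (Skelφ.Prm.hR'₂ O.D (Sgn.Mu O) G Φ.φ Φ.types)
    ((Skelφ.Prm.hr₀₁ O.D (Sgn.Mu O) G Φ.φ Φ.types (Sgn.ρz O)).trans hrs) ((Skelφ.Prm.hr₀₂ O.D (Sgn.Mu O) G Φ.φ Φ.types (Sgn.ρz O)).trans hrs)
    (Sgn₂.r₀_le_Lp hat) hRtF.2.2.2.1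
    (Skelφ.Prm.hrs₁ O.D (Sgn.Mu O) G Φ.φ Φ.types (Sgn.ρz O)) (Skelφ.Prm.hrs₂ O.D (Sgn.Mu O) G Φ.φ Φ.types (Sgn.ρz O))
    (Skelφ.Prm.hcU O.D (Sgn.Mu O) Φ.Δ)
    (fun du => (Sgn₂.root_route_at hat du.1).2.2.2.1)
    (fun du k hk _ ℓ h₁ h₂ => ((Sgn₂.root_route_at hat du.1).2.2.2.2.2 ℓ h₁ h₂).1)
    (fun du k hk _ ℓ h₁ h₂ => ((Sgn₂.root_route_at hat du.1).2.2.2.2.2 ℓ h₁ h₂).2)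
    (fun du k hk I ℓ h₁ h₂ => Sgn₂.hdepth_range_at hat du.1 I ((Sgn₂.root_route_at hat du.1).1.trans h₁)
      (h₂.trans ((Sgn₂.root_route_at hat du.1).2.1.trans (Sgn₂.root_route_at hat du.1).2.2.1)))
    (fun du k hk ℓ h₁ h₂ => by
      show Skelφ.StepI.widths O.D.Gb O.D.Fb du.1 ℓ (oth du.1) ≤ Skelφ.StepI.widths O.D.Gb O.D.Fb du.1 (max ℓ (Sgn₂.ℓ₀ κ Φ p O du.1)) (oth du.1)
      rw [max_eq_left (show Sgn₂.ℓ₀ κ Φ p O du.1 ≤ ℓ from h₁)])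
    (fun _ => Sgn.kP κ Φ p O) (fun _ => (Sgn₂.hN (κ := κ) (Φ := Φ) (p := p) (O := O) hp0 hp1).1) (fun du => (hacc du).2.2.2.2.2.1)
    (mex := 60 * (Sgn₂.cells κ Φ p O).rmax) (R₁ := Sgn₂.Rex κ Φ p O q (Skelφ.Prm.E₀ (Sgn₂.schedIn κ Φ p O q) + 1)) (η := Sgn.η κ Φ)
    (fun du => (hacc du).2.2.1) le_rfl
    (fun R'' hR'' Rw D' A' hD' hbox hA' hA'' => Sgn₂.hRex_at hat _ t R'' hR'' Rw D' A' hD' hbox hA' hA'') hRtF.2.2.2.2.2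
    (ℓ1 := fun du => Sgn₂.ℓ1 κ Φ p O du.1)
    (fun du h0' => by rw [show Sgn₂.ℓ1 κ Φ p O du.1 = Sgn₂.ℓ1 κ Φ p O 0 by rw [h0']]; exact (hhop du).1)
    (fun du h1' => by rw [show Sgn₂.ℓ1 κ Φ p O du.1 = Sgn₂.ℓ1 κ Φ p O 1 by rw [h1']]; exact (hhop du).2.1)
    (fun du => by rw [hcaR]; exact_mod_cast (hhop du).2.2.1)
    (fun du => by exact_mod_cast (hhop du).2.2.2.1)
    (fun du => by
      have h3 := (hhop du).2.2.1
      have h5 := (hhop du).2.2.2.2.1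
      rw [hcaR]
      have : ((Sgn₂.caR κ Φ p O du.1 - Sgn₂.ℓ1 κ Φ p O du.1 + O.D.k : ℕ) : ℤ) ≤ ((5 * (Sgn₂.cells κ Φ p O).r du.1 : ℕ) : ℤ) := by exact_mod_cast h5
      push_cast [Nat.cast_sub h3] at this
      linarith)
    (fun du => by exact_mod_cast (hhop du).2.2.2.2.2.2)
    (fun du => le_rfl)
    (R₀ := Sgn₂.R₀U κ Φ p O) (Rp := Sgn₂.RpU κ Φ p O)
    (fun du => by rw [← hRΛ.1]; exact (hdep du).1) ((hdep (0, true)).2.2.1.trans hEQ) (hdep (0, true)).2.2.2.2.1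
    (fun du => (hdep du).2.1) ((hdep (0, true)).2.2.2.1.trans hEQ)
    (fun du => (Nat.succ_le_succ (hdep du).2.2.2.2.2).trans (hRB du))
    (fun du => (Nat.succ_le_succ (hdep du).2.2.2.2.2).trans (hRQ du))
    (hdep (0, true)).2.2.2.2.2

end PlanarSkeletonSign

end Summit.CriticalPhenomena.PercolationContinuityZ3.Theorems.Transplant

end
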